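import Summits.Ventures.QEC.Census.BB.A1s_n192_k4_0fa3ae82.WitA
import Summits.Ventures.QEC.Census.BB.A1s_n192_k4_0fa3ae82.WitB
import Summits.Ventures.QEC.Census.BB.A1s_n192_k4_0fa3ae82.WitC
import HarnessLib

set_option Elab.async false
set_option maxRecDepth 200000

/-!
# `[[192,4,18]]` one-level cover certificate — WITNESS TABLE of the level-1 list: the kernel-generated orbit table `orbTab eTr eInv 48 eReps`
# is a valid witness table (`witnessOK`) — qec-type-10's round-trip check `orbCheck` assembled from the 9 chunk verdicts of `WitA/B/C`
(`orbCheckAux_append`, proved here) and `CertCoverBatch.witnessOK_of_orbCheck`; the 48 downstairs tables `ePermqs` are permutation tables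
(`permListOK`). qec-search-9 g5 (lead block 170 (0)(c)). Theorems only; KERNEL.
-/

namespace Summit.Ventures.QEC.Census.A1s_n192_k4_0fa3ae82

open Matrix Summit.Ventures.QEC.Census Literature.InformationTheory.QuantumCodes

/-- The round-trip walk is conjunctive over concatenation. -/
theorem orbCheckAux_append (permqs : List (List ℕ)) (tr : ℕ → ℕ → ℕ) (inv : ℕ → ℕ) (na : ℕ) :
    ∀ A B : List ℕ, orbCheckAux permqs tr inv na (A ++ B) = (orbCheckAux permqs tr inv na A && orbCheckAux permqs tr inv na B)
  | [], B => by simp [orbCheckAux]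
  | r :: A, B => by
    rw [List.cons_append, orbCheckAux, orbCheckAux, orbCheckAux_append permqs tr inv na A B, Bool.and_assoc]

/-- The chunks are `eReps`. -/
theorem repsC_eq : repsC0 ++ repsC1 ++ repsC2 ++ repsC3 ++ repsC4 ++ repsC5 ++ repsC6 ++ repsC7 ++ repsC8 = eReps := by decide +kernel

/-- **The round trip of the whole orbit table.** -/
theorem eOrb_check : orbCheck ePermqs eTr eInv 48 eReps = true := by
  rw [← repsC_eq]
  simp only [orbCheck, orbCheckAux_append, Bool.and_eq_true]
  exact ⟨⟨⟨⟨⟨⟨⟨⟨orbChk0, orbChk1⟩, orbChk2⟩, orbChk3⟩, orbChk4⟩, orbChk5⟩, orbChk6⟩, orbChk7⟩, orbChk8⟩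

/-- The 48 downstairs tables are permutation tables of the 96 qubits. -/
theorem ePermqs_ok : ∀ i : ℕ, i < ePermqs.length → permListOK 96 (ePermqs.getD i []) = true := by
  have h : ((List.range 48).all fun i => permListOK 96 (ePermqs.getD i [])) = true := by decide +kernel
  have hl : ePermqs.length = 48 := by decide
  intro i hi
  rw [hl] at hi
  simp only [List.all_eq_true, List.mem_range] at h
  exact h i hi

/-- ★ **`wit_ok`**: the generated orbit table is a valid witness table for `eReps` over `ePermqs`. -/
theorem wit_ok : witnessOK 96 ePermqs eReps (orbTab eTr eInv 48 eReps) = true := witnessOK_of_orbCheck ePermqs_ok eOrb_check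

/-- `hcw`: the orbit word list is covered by its own table. -/
theorem hcw : coveredOK eOrb (orbTab eTr eInv 48 eReps) = true := coveredOK_orbWords eReps

end Summit.Ventures.QEC.Census.A1s_n192_k4_0fa3ae82
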